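import Literature.Probability.Percolation.MarkedLoopTriangleCount
import HarnessLib

/-!
# The tripod-law solution space as a `Z/k`-module when `3 ∣ k`

Topic `Literature/Probability/Percolation`; generic-`k` layer, a rider on `MarkedLoopTripodCharacter.lean` («TRIPOD-REP»: for `3 ∤ k` the rotation
acts on `solW k` with vanishing character off the identity, so every `k`-th root of unity has the same multiplicity; for `3 ∣ k` the character
at `rot^{k/3}` is `−τ² · N`, `N` = number of invariant triangle pictures; «the value at `rot^{2k/3}` … not typed») and on
`MarkedLoopTriangleCount.lean` («TRIANGLE-COUNT»: `N = (k/3) · #NCMatching (k/3 − 1) = (k/3) · C_{(k−3)/6}`). THIS FILE COMPLETES THE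
CHARACTER TABLE FOR `3 ∣ k` AND READS OFF EVERY EIGENVALUE MULTIPLICITY — the lane's door (G) («what is `solW k` as a `ℂ[Z/k]`-module?»)
for every odd `k`.

## Content (`k = 3r`)
* ★ `trace_solWRot_pow_eq_zero_of_not_dvd` — `tr (rot^j | solW k) = 0` unless `k ∣ 3j` (a fixed picture forces a fixed point of `rot^{3j}`).
* `relMap_rot_pow_two_mul_eq_self_iff` (`rot^{2r}`-invariance = `rot^r`-invariance), ★ `shift_two_thirds_eq_self_iff` — the pictures fixed
  by the transport along `rot^{2r}` are again the invariant triangles (`IsInvTri`), ★ with phase `τ` (`shiftPhase_two_thirds_eq`);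
  ★★ `trace_solWRot_two_thirds_eq : tr (rot^{2r} | solW k) = −τ · N` (REP's missing value), `trace_solWRot_third_eq'` (the `rot^r` value in the
  same currency), `triN r = N = r · #NCMatching (r − 1)` (as a complex number), `trace_rotOp_three_mul` (all `j < k` at once).
* ★★ `trace_twAvgOp_three_mul` — REP's twisted average `A_ζ = Σ_j ζ^{-j} R_j` has trace `dim solW k − N (τ² ω + τ ω²)`, `ω = ζ^{-r}`; ★★★
  `finrank_eigenspace_three_mul : k · dim E_ζ = dim solW k − N (τ² ω + τ ω²)` for every `ζ^k = 1` (`E_ζ` = range of REP's projector `twProj`);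
  ★★★ `finrank_eigenspace_of_ne_tau : k · dim E_ζ = dim solW k + N` (`ω ≠ τ`, i.e. `ω ∈ {1, τ²}`), ★★★ `finrank_eigenspace_of_eq_tau :
  k · dim E_ζ = dim solW k − 2N` (`ω = τ`).
* Odd `k = 3(2s+1)` in Catalan numbers (`dim solW k = C_{3s+2}` by LINK-CATALAN, `N = (2s+1) C_s` by TRIANGLE-COUNT; `triN_eq`,
  `finrank_solW_three_mul_odd`): ★★★ `mul_finrank_eigenspace_of_ne_tau : k · dim E_ζ = C_{3s+2} + (2s+1) C_s`, ★★★
  `mul_finrank_eigenspace_of_eq_tau : k · dim E_ζ = C_{3s+2} − 2 (2s+1) C_s` (the `τ`-class is non-empty: `exists_root_tau_class`, private),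
  ★★ `mul_finrank_invariants_three_mul` (`ζ = 1`: the rotation-invariant solutions), ★ `two_mul_triangles_le_catalan` (`2 (2s+1) C_s ≤ C_{3s+2}`),
  ★ `dvd_catalan_add_and_sub` (`3(2s+1) ∣ C_{3s+2} + (2s+1) C_s` and `∣ C_{3s+2} − 2 (2s+1) C_s` — the arithmetic shadows, as REP's
  `dvd_card_ncMatching` was for `3 ∤ k`), `multiplicities_three_nine` (k = 3: one invariant line, multiplicities `1, 1, 0` for `ζ = 1, τ, τ²`;
  k = 9: `9 · dim E_1 = 45`, the `τ`-class `36`: six eigenvalues of multiplicity `5`, three of multiplicity `4`, `6·5 + 3·4 = 42 = C_5`).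
* For comparison, `3 ∤ k = 2l+1` (REP's freeness evaluated by LINK-CATALAN): ★★ `mul_finrank_eigenspace_of_coprime : k · dim E_ζ = C_{l+1}` for
  every `ζ^k = 1`, `dvd_catalan_of_coprime : k ∣ C_{l+1}` — so this file plus REP give the `ℂ[Z/k]`-module structure of `solW k` for EVERY odd `k`.
* ★★ `finrank_eigenspace_lt_of_three_mul` / `exists_finrank_eigenspace_lt` — FOR `3 ∣ k` THE MODULE IS NOT FREE (the `τ`-class multiplicity is strictly smaller),
  the exact complement of REP's freeness for `3 ∤ k`.

## References
* M. Khristoforov, S. Smirnov, *Percolation and O(1) loop model*, arXiv:2111.15612 (2021), §1.2 (arXiv v1 p. 2: cyclic indexing), §2 Lemma 4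
  with its proof and Fig. 3 (p. 4).
-/

open Finset

namespace Literature.Probability.Percolation.MarkedLoops

open Literature.Probability.Percolation.FivePoint (tau)

section OrderThreeModule

variable {nm r : ℕ}

/-! #### The character vanishes off `{0, k/3, 2k/3}` -/

/-- ★ **`tr (rot^j | solW k) = 0` UNLESS `k ∣ 3j`**: a picture fixed by the re-ordered transport along `rot^j` would give a fixed point of
`rot^{3j}` (REP's `exists_fixed_of_shift_eq`), so the monomial trace formula has no fixed points. [cite: KhristoforovSmirnov2021, §2 Lemma 4,
proof and Fig. 3 (arXiv v1 p. 4); §1.2 (p. 2: cyclic indexing)] -/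
theorem trace_solWRot_pow_eq_zero_of_not_dvd {j : ℕ} (hj : ¬ nm ∣ 3 * j) :
    LinearMap.trace ℂ (solW nm) (solWRot nm (rot nm ^ j) (isCyc_rot_pow j)).toLinearMap = 0 := by
  classical
  have hj' : ¬ nm ∣ j := fun h => hj (Dvd.dvd.mul_left h 3)
  rw [trace_solWRot_pow_eq_neg_sum_fixed hj', Finset.sum_eq_zero, neg_zero]
  intro P hP
  exfalso
  obtain ⟨x, hx⟩ := exists_fixed_of_shift_eq (isCyc_rot_pow j) P (Finset.mem_filter.1 hP).2
  rw [rot_pow_three_apply] at hx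
  exact hj ((rot_pow_apply_eq_self_iff (3 * j) x).1 hx)

/-! #### The transport along `rot^{2k/3}` fixes the same triangles, with phase `τ` -/

/-- `rot^{2r}`-invariance of a relation is `rot^r`-invariance (`k = 3r`). [cite: KhristoforovSmirnov2021, §1.2 (arXiv v1 p. 2: cyclic indexing)] -/
theorem relMap_rot_pow_two_mul_eq_self_iff (hr : 3 * r = nm) (L : Finset (Fin nm × Fin nm)) :
    relMap (rot nm ^ (2 * r)) L = L ↔ relMap (rot nm ^ r) L = L := by
  constructor
  · intro h
    have h2 : relMap (rot nm ^ (2 * r)) (relMap (rot nm ^ (2 * r)) L) = L := by rw [h, h]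
    rw [relMap_rot_pow_rot_pow, show 2 * r + 2 * r = r + nm by omega, ← relMap_rot_pow_rot_pow, relMap_rot_pow_self] at h2
    exact h2
  · intro h
    rw [show 2 * r = r + r by omega, ← relMap_rot_pow_rot_pow, h, h]

/-- ★ **THE PICTURES FIXED BY THE RE-ORDERED TRANSPORT ALONG `rot^{2r}` ARE THE INVARIANT TRIANGLES** (`k = 3r`), exactly as for `rot^r`.
[cite: KhristoforovSmirnov2021, §1.2 (arXiv v1 p. 2: cyclic indexing); §2 Lemma 4, Fig. 3 (p. 4)] -/
theorem shift_two_thirds_eq_self_iff (hr : 3 * r = nm) (hpos : 0 < r) (P : Pic nm) :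
    Pic.shift (isCyc_rot_pow (2 * r)) P = P ↔ IsInvTri r P := by
  have hrk : 2 * r < nm := by omega
  have hα := val_rot_pow_or hrk P.α
  have hβ := val_rot_pow_or hrk P.β
  have hγ := val_rot_pow_or hrk P.γ
  have l1 := P.lt₁; have l2 := P.lt₂
  have bα := P.α.2; have bβ := P.β.2; have bγ := P.γ.2
  rw [Fin.lt_def] at l1 l2
  constructor
  · intro h
    unfold Pic.shift at h
    by_cases h1 : (rot nm ^ (2 * r)) P.α < (rot nm ^ (2 * r)) P.β ∧ (rot nm ^ (2 * r)) P.β < (rot nm ^ (2 * r)) P.γ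
    · rw [dif_pos h1] at h
      have e : (rot nm ^ (2 * r)) P.α = P.α := congrArg Pic.α h
      exact absurd ((rot_pow_apply_eq_self_iff (2 * r) P.α).1 e) (fun hd => by have := Nat.le_of_dvd (by omega) hd; omega)
    · rw [dif_neg h1] at h
      by_cases h2 : (rot nm ^ (2 * r)) P.β < (rot nm ^ (2 * r)) P.γ ∧ (rot nm ^ (2 * r)) P.γ < (rot nm ^ (2 * r)) P.α
      · rw [dif_pos h2] at h
        have e1 := congrArg Fin.val (congrArg Pic.α h)   -- rot β = α
        have e2 := congrArg Fin.val (congrArg Pic.β h)   -- rot γ = β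
        have e3 := congrArg Fin.val (congrArg Pic.γ h)   -- rot α = γ
        have e4 : relMap (rot nm ^ (2 * r)) P.L₀ = P.L₀ := congrArg Pic.L₀ h
        change (((rot nm ^ (2 * r)) P.β : Fin nm) : ℕ) = P.α.val at e1
        change (((rot nm ^ (2 * r)) P.γ : Fin nm) : ℕ) = P.β.val at e2
        change (((rot nm ^ (2 * r)) P.α : Fin nm) : ℕ) = P.γ.val at e3
        exact ⟨by omega, by omega, (relMap_rot_pow_two_mul_eq_self_iff hr _).1 e4⟩
      · rw [dif_neg h2] at h
        have e2 := congrArg Fin.val (congrArg Pic.β h)   -- rot α = β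
        have e3 := congrArg Fin.val (congrArg Pic.γ h)   -- rot β = γ
        change (((rot nm ^ (2 * r)) P.α : Fin nm) : ℕ) = P.β.val at e2
        change (((rot nm ^ (2 * r)) P.β : Fin nm) : ℕ) = P.γ.val at e3
        exfalso; omega
  · rintro ⟨hb, hc, hL⟩
    have eα : (rot nm ^ (2 * r)) P.α = P.γ := Fin.ext (by rcases hα with h | h <;> omega)
    have eβ : (rot nm ^ (2 * r)) P.β = P.α := Fin.ext (by rcases hβ with h | h <;> omega)
    have eγ : (rot nm ^ (2 * r)) P.γ = P.β := Fin.ext (by rcases hγ with h | h <;> omega)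
    have hL2 : relMap (rot nm ^ (2 * r)) P.L₀ = P.L₀ := (relMap_rot_pow_two_mul_eq_self_iff hr _).2 hL
    unfold Pic.shift
    have n1 : ¬ ((rot nm ^ (2 * r)) P.α < (rot nm ^ (2 * r)) P.β ∧ (rot nm ^ (2 * r)) P.β < (rot nm ^ (2 * r)) P.γ) := by
      rw [eα, eβ, eγ, Fin.lt_def, Fin.lt_def]; omega
    have y2 : (rot nm ^ (2 * r)) P.β < (rot nm ^ (2 * r)) P.γ ∧ (rot nm ^ (2 * r)) P.γ < (rot nm ^ (2 * r)) P.α := by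
      rw [eα, eβ, eγ, Fin.lt_def, Fin.lt_def]; omega
    rw [dif_neg n1, dif_pos y2]
    obtain ⟨⟨⟨a, b, c⟩, L⟩, hP⟩ := P
    simp only [Pic.α, Pic.β, Pic.γ, Pic.L₀] at eα eβ eγ hL2 ⊢
    apply Subtype.ext
    simp only [hL2, eα, eβ, eγ]

/-- ★ … and on them the phase of the `rot^{2r}`-transport is `τ`. [cite: KhristoforovSmirnov2021, §2 Lemma 4, proof and Fig. 3 (arXiv v1 p. 4)] -/
theorem shiftPhase_two_thirds_eq (hr : 3 * r = nm) (hpos : 0 < r) (P : Pic nm) (h : Pic.shift (isCyc_rot_pow (2 * r)) P = P) :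
    Pic.shiftPhase (isCyc_rot_pow (2 * r)) P = tau := by
  have hrk : 2 * r < nm := by omega
  obtain ⟨hb, hc, -⟩ := (shift_two_thirds_eq_self_iff hr hpos P).1 h
  have hα := val_rot_pow_or hrk P.α
  have hβ := val_rot_pow_or hrk P.β
  have hγ := val_rot_pow_or hrk P.γ
  have bα := P.α.2; have bβ := P.β.2; have bγ := P.γ.2
  have l1 := P.lt₁; have l2 := P.lt₂
  rw [Fin.lt_def] at l1 l2
  have eα : (rot nm ^ (2 * r)) P.α = P.γ := Fin.ext (by rcases hα with h | h <;> omega)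
  have eβ : (rot nm ^ (2 * r)) P.β = P.α := Fin.ext (by rcases hβ with h | h <;> omega)
  have eγ : (rot nm ^ (2 * r)) P.γ = P.β := Fin.ext (by rcases hγ with h | h <;> omega)
  unfold Pic.shiftPhase
  rw [eα, eβ, eγ, if_neg (by rw [Fin.lt_def, Fin.lt_def]; omega), if_pos (by rw [Fin.lt_def, Fin.lt_def]; omega)]

/-- ★★ **THE CHARACTER AT `rot^{2k/3}`** (`k = 3r`): `tr (rot^{2r} | solW k) = −τ · (r · #NCMatching (r − 1))` — REP's missing value, the complex
conjugate partner of `trace_solWRot_third_eq`. [cite: KhristoforovSmirnov2021, §2 Lemma 4, proof and Fig. 3 (arXiv v1 p. 4); §1.2 (p. 2)] -/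
theorem trace_solWRot_two_thirds_eq (hr : 3 * r = nm) (hpos : 0 < r) :
    LinearMap.trace ℂ (solW nm) (solWRot nm (rot nm ^ (2 * r)) (isCyc_rot_pow (2 * r))).toLinearMap =
      -(tau * ((r * Fintype.card (NCMatching (r - 1)) : ℕ) : ℂ)) := by
  classical
  have hnd : ¬ nm ∣ 2 * r := fun hd => by have := Nat.le_of_dvd (by omega) hd; omega
  rw [trace_solWRot_pow_eq_neg_sum_fixed hnd,
    Finset.sum_congr rfl fun P hP => shiftPhase_two_thirds_eq hr hpos P (Finset.mem_filter.1 hP).2, Finset.sum_const, nsmul_eq_mul,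
    mul_comm, ← card_isInvTri hr hpos]
  congr 3
  symm
  exact Fintype.card_of_subtype _ fun P => by
    rw [Finset.mem_filter]
    exact ⟨fun h => (shift_two_thirds_eq_self_iff hr hpos P).1 h.2, fun h => ⟨Finset.mem_univ _, (shift_two_thirds_eq_self_iff hr hpos P).2 h⟩⟩

/-- the `rot^{k/3}` value in the same `r · #NCMatching (r − 1)` currency (REP + TRIANGLE-COUNT). [cite: KhristoforovSmirnov2021, §2 Lemma 4, proof
and Fig. 3 (arXiv v1 p. 4)] -/
theorem trace_solWRot_third_eq' (hr : 3 * r = nm) (hpos : 0 < r) :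
    LinearMap.trace ℂ (solW nm) (solWRot nm (rot nm ^ r) (isCyc_rot_pow r)).toLinearMap =
      -(tau ^ 2 * ((r * Fintype.card (NCMatching (r - 1)) : ℕ) : ℂ)) := by
  classical
  rw [trace_solWRot_third_eq hr hpos, card_invariantTriangles hr hpos]

/-! #### The twisted averages and every eigenvalue multiplicity -/

/-- the number of invariant triangles, as a complex number: `N = r · #NCMatching (r − 1)`. [cite: KhristoforovSmirnov2021, §2 Lemma 4, Fig. 3
(arXiv v1 p. 4)] -/
noncomputable def triN (r : ℕ) : ℂ := ((r * Fintype.card (NCMatching (r - 1)) : ℕ) : ℂ)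

/-- the trace of a single rotation power, all cases (`k = 3r`, `j < k`). [cite: KhristoforovSmirnov2021, §2 Lemma 4, proof and Fig. 3 (arXiv v1
p. 4); §1.2 (p. 2)] -/
theorem trace_rotOp_three_mul (hr : 3 * r = nm) (hpos : 0 < r) {j : ℕ} (hj : j < nm) :
    LinearMap.trace ℂ (solW nm) (rotOp nm j) =
      if j = 0 then (Module.finrank ℂ (solW nm) : ℂ) else if j = r then -(tau ^ 2 * triN r) else if j = 2 * r then -(tau * triN r) else 0 := by
  by_cases h0 : j = 0
  · subst h0; rw [if_pos rfl, rotOp_zero, LinearMap.trace_id]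
  rw [if_neg h0]
  by_cases h1 : j = r
  · subst h1; rw [if_pos rfl]; exact trace_solWRot_third_eq' hr hpos
  rw [if_neg h1]
  by_cases h2 : j = 2 * r
  · subst h2; rw [if_pos rfl]; exact trace_solWRot_two_thirds_eq hr hpos
  rw [if_neg h2]
  exact trace_solWRot_pow_eq_zero_of_not_dvd (fun hd => by
    obtain ⟨c, hc⟩ := hd
    have : c < 3 := by
      by_contra hc3
      have := Nat.mul_le_mul_left nm (Nat.le_of_not_lt hc3)
      omega
    interval_cases c <;> omega)

/-- ★★ **THE TRACE OF THE TWISTED AVERAGE** `A_ζ = Σ_{j<k} ζ^{-j} R_j` for `k = 3r`: `dim solW k − N · (τ² ω + τ ω²)` with `ω = ζ^{-r}`.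
[cite: KhristoforovSmirnov2021, §2 Lemma 4, proof and Fig. 3 (arXiv v1 p. 4); §1.2 (p. 2: cyclic indexing)] -/
theorem trace_twAvgOp_three_mul (hr : 3 * r = nm) (hpos : 0 < r) (ζ : ℂ) :
    LinearMap.trace ℂ (solW nm) (twAvgOp nm ζ) =
      (Module.finrank ℂ (solW nm) : ℂ) - triN r * (tau ^ 2 * (ζ⁻¹) ^ r + tau * (ζ⁻¹) ^ (2 * r)) := by
  unfold twAvgOp
  rw [map_sum]
  have hsub : ({0, r, 2 * r} : Finset ℕ) ⊆ Finset.range nm := by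
    intro j hj
    simp only [Finset.mem_insert, Finset.mem_singleton] at hj
    rw [Finset.mem_range]; omega
  rw [← Finset.sum_subset hsub]
  · rw [Finset.sum_insert (by simp only [Finset.mem_insert, Finset.mem_singleton]; omega),
      Finset.sum_pair (by omega), map_smul, map_smul, map_smul, trace_rotOp_three_mul hr hpos (j := 0) (by omega),
      trace_rotOp_three_mul hr hpos (j := r) (by omega), trace_rotOp_three_mul hr hpos (j := 2 * r) (by omega), if_pos rfl,
      if_neg (by omega), if_pos rfl, if_neg (by omega), if_neg (by omega), if_pos rfl, pow_zero, one_smul, smul_eq_mul, smul_eq_mul]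
    ring
  · intro j hj hj'
    rw [Finset.mem_range] at hj
    simp only [Finset.mem_insert, Finset.mem_singleton, not_or] at hj'
    rw [map_smul, trace_rotOp_three_mul hr hpos hj, if_neg hj'.1, if_neg hj'.2.1, if_neg hj'.2.2, smul_zero]

/-- ★★★ **EVERY EIGENVALUE MULTIPLICITY OF THE ROTATION ON THE TRIPOD-LAW SOLUTION SPACE, `3 ∣ k`**: for `k = 3r` and `ζ^k = 1`, with `E_ζ`
the `ζ`-eigenspace (the range of REP's projector `twProj`) and `ω = ζ^{-r}`:
`k · dim E_ζ = dim solW k − N (τ² ω + τ ω²)`, `N = r · #NCMatching (r − 1)`. [cite: KhristoforovSmirnov2021, §2 Lemma 4, proof and Fig. 3 (arXiv v1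
p. 4); §1.2 (p. 2: cyclic indexing)] -/
theorem finrank_eigenspace_three_mul (hr : 3 * r = nm) (hpos : 0 < r) {ζ : ℂ} (hζ : ζ ^ nm = 1) :
    (nm : ℂ) * (Module.finrank ℂ (LinearMap.range (twProj nm ζ)) : ℂ) =
      (Module.finrank ℂ (solW nm) : ℂ) - triN r * (tau ^ 2 * (ζ⁻¹) ^ r + tau * (ζ⁻¹) ^ (2 * r)) := by
  have hk : 0 < nm := by omega
  have hk' : (nm : ℂ) ≠ 0 := Nat.cast_ne_zero.2 (by omega)
  have hP : LinearMap.IsProj (LinearMap.range (twProj nm ζ)) (twProj nm ζ) :=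
    (LinearMap.isProj_range_iff_isIdempotentElem _).2 (isIdempotentElem_twProj hk hζ)
  haveI : Module.Free ℂ (LinearMap.range (twProj nm ζ)) := @Module.Free.of_divisionRing ℂ (LinearMap.range (twProj nm ζ)) _ _ _
  haveI : Module.Free ℂ (LinearMap.ker (twProj nm ζ)) := @Module.Free.of_divisionRing ℂ (LinearMap.ker (twProj nm ζ)) _ _ _
  have htr : LinearMap.trace ℂ (solW nm) (twProj nm ζ) = (Module.finrank ℂ (LinearMap.range (twProj nm ζ)) : ℂ) := hP.trace
  have h2 : LinearMap.trace ℂ (solW nm) (twProj nm ζ) = (nm : ℂ)⁻¹ * LinearMap.trace ℂ (solW nm) (twAvgOp nm ζ) := by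
    unfold twProj
    rw [map_smul, smul_eq_mul]
  rw [← htr, h2, ← mul_assoc, mul_inv_cancel₀ hk', one_mul, trace_twAvgOp_three_mul hr hpos]

/-- the cube roots of unity in `ℂ` are `1, τ, τ²`. [folklore] -/
private theorem cube_root_cases {ω : ℂ} (h : ω ^ 3 = 1) : ω = 1 ∨ ω = tau ∨ ω = tau ^ 2 := by
  have hprim : IsPrimitiveRoot tau 3 := by
    have h' := Complex.isPrimitiveRoot_exp 3 (by norm_num)
    unfold tau
    convert h' using 2
    push_cast
    ring
  have hsum := hprim.geom_sum_eq_zero (by norm_num : 1 < 3)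
  simp only [Finset.sum_range_succ, Finset.sum_range_zero, pow_zero, pow_one, zero_add] at hsum
  have h3 : tau ^ 3 = 1 := hprim.pow_eq_one
  have key : (ω - 1) * (ω - tau) * (ω - tau ^ 2) = 0 := by
    have e : (ω - 1) * (ω - tau) * (ω - tau ^ 2) = ω ^ 3 - 1 - (1 + tau + tau ^ 2) * ω ^ 2 + (1 + tau + tau ^ 2) * tau * ω + (1 - tau ^ 3) := by
      ring
    rw [e, h, hsum, h3]; ring
  rcases mul_eq_zero.1 key with h12 | h3'
  · rcases mul_eq_zero.1 h12 with h1' | h2'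
    · exact Or.inl (sub_eq_zero.1 h1')
    · exact Or.inr (Or.inl (sub_eq_zero.1 h2'))
  · exact Or.inr (Or.inr (sub_eq_zero.1 h3'))

/-- `τ² + τ = −1` and `τ³ = 1`. [folklore] -/
private theorem tau_facts : tau ^ 2 + tau = -1 ∧ tau ^ 3 = 1 := by
  have hprim : IsPrimitiveRoot tau 3 := by
    have h' := Complex.isPrimitiveRoot_exp 3 (by norm_num)
    unfold tau
    convert h' using 2
    push_cast
    ring
  have hsum := hprim.geom_sum_eq_zero (by norm_num : 1 < 3)
  simp only [Finset.sum_range_succ, Finset.sum_range_zero, pow_zero, pow_one, zero_add] at hsum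
  exact ⟨by linear_combination hsum, hprim.pow_eq_one⟩

/-- `ω = ζ^{-r}` is a cube root of unity when `ζ^{3r} = 1`. [folklore] -/
private theorem omega_cube (hr : 3 * r = nm) {ζ : ℂ} (hζ : ζ ^ nm = 1) : ((ζ⁻¹) ^ r) ^ 3 = 1 := by
  rw [← pow_mul, mul_comm, hr, inv_pow, hζ, inv_one]

/-- ★★★ **MULTIPLICITY WHEN `ζ^{-r} ≠ τ`** (i.e. `ζ^{-r} ∈ {1, τ²}`: two thirds of the `k`-th roots of unity): `k · dim E_ζ = dim solW k + N`.
[cite: KhristoforovSmirnov2021, §2 Lemma 4, proof and Fig. 3 (arXiv v1 p. 4); §1.2 (p. 2)] -/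
theorem finrank_eigenspace_of_ne_tau (hr : 3 * r = nm) (hpos : 0 < r) {ζ : ℂ} (hζ : ζ ^ nm = 1) (hω : (ζ⁻¹) ^ r ≠ tau) :
    (nm : ℂ) * (Module.finrank ℂ (LinearMap.range (twProj nm ζ)) : ℂ) = (Module.finrank ℂ (solW nm) : ℂ) + triN r := by
  obtain ⟨h1, h3⟩ := tau_facts
  rw [finrank_eigenspace_three_mul hr hpos hζ, pow_mul']
  rcases cube_root_cases (omega_cube hr hζ) with e | e | e
  · rw [e]; linear_combination (-(triN r)) * h1
  · exact absurd e hω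
  · rw [e]; linear_combination (-(triN r) * (tau + tau ^ 2)) * h3 + (-(triN r)) * h1

/-- ★★★ **MULTIPLICITY WHEN `ζ^{-r} = τ`** (one third of the `k`-th roots of unity): `k · dim E_ζ = dim solW k − 2N`.
[cite: KhristoforovSmirnov2021, §2 Lemma 4, proof and Fig. 3 (arXiv v1 p. 4); §1.2 (p. 2)] -/
theorem finrank_eigenspace_of_eq_tau (hr : 3 * r = nm) (hpos : 0 < r) {ζ : ℂ} (hζ : ζ ^ nm = 1) (hω : (ζ⁻¹) ^ r = tau) :
    (nm : ℂ) * (Module.finrank ℂ (LinearMap.range (twProj nm ζ)) : ℂ) = (Module.finrank ℂ (solW nm) : ℂ) - 2 * triN r := by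
  obtain ⟨-, h3⟩ := tau_facts
  rw [finrank_eigenspace_three_mul hr hpos hζ, pow_mul', hω]
  linear_combination (-(2 : ℂ) * triN r) * h3

/-! #### Odd `k = 3(2s+1)`: everything in Catalan numbers, and the arithmetic shadows -/

/-- **the `τ`-class is non-empty**: `ζ₀ = exp(4πi/k)` is a `k`-th root of unity with `ζ₀^{-r} = τ` (`k = 3r`). [folklore] -/
private theorem exists_root_tau_class (hr : 3 * r = nm) (hpos : 0 < r) : ∃ ζ : ℂ, ζ ^ nm = 1 ∧ (ζ⁻¹) ^ r = tau := by
  have hk0 : (nm : ℂ) ≠ 0 := Nat.cast_ne_zero.2 (by omega)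
  have hr0 : (r : ℂ) ≠ 0 := Nat.cast_ne_zero.2 (by omega)
  have hk : (nm : ℂ) = 3 * r := by rw [← hr]; push_cast; ring
  refine ⟨Complex.exp (2 * Real.pi * Complex.I * (2 / nm)), ?_, ?_⟩
  · rw [← Complex.exp_nat_mul]
    have e : (nm : ℂ) * (2 * Real.pi * Complex.I * (2 / nm)) = (2 : ℕ) * (2 * Real.pi * Complex.I) := by
      field_simp
      push_cast
      ring
    rw [e, Complex.exp_nat_mul, Complex.exp_two_pi_mul_I, one_pow]
  · rw [← Complex.exp_neg, ← Complex.exp_nat_mul]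
    have e : (r : ℂ) * -(2 * Real.pi * Complex.I * (2 / nm)) = 2 * Real.pi * Complex.I / 3 + (-1 : ℤ) * (2 * Real.pi * Complex.I) := by
      rw [hk]
      field_simp
      push_cast
      ring
    rw [e, Complex.exp_add, Complex.exp_int_mul, Complex.exp_two_pi_mul_I, one_zpow, mul_one]
    rfl

/-- `N` in Catalan form for odd `k = 3(2s+1)`: `N = (2s+1) · C_s`. [cite: KhristoforovSmirnov2021, §2 Lemma 4, Fig. 3 (arXiv v1 p. 4)] -/
theorem triN_eq (s : ℕ) : triN (2 * s + 1) = (((2 * s + 1) * catalan s : ℕ) : ℂ) := by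
  unfold triN
  rw [show 2 * s + 1 - 1 = 2 * s by omega, card_ncMatching_two_mul]

/-- the solution-space dimension for `k = 3(2s+1)` is `C_{3s+2}` (LINK-CATALAN). [cite: KhristoforovSmirnov2021, §2 Lemma 4 (arXiv v1 p. 4)] -/
theorem finrank_solW_three_mul_odd {s : ℕ} (hr : 3 * (2 * s + 1) = nm) : Module.finrank ℂ (solW nm) = catalan (3 * s + 2) := by
  rw [← hr, show 3 * (2 * s + 1) = 2 * (3 * s + 1) + 1 by ring, finrank_solW_eq_catalan]

/-- ★ **`2 (2s+1) C_s ≤ C_{3s+2}`** — the arithmetic shadow of `dim E_ζ ≥ 0` in the `τ`-class. [cite: KhristoforovSmirnov2021, §2 Lemma 4, proof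
and Fig. 3 (arXiv v1 p. 4)] -/
theorem two_mul_triangles_le_catalan (s : ℕ) : 2 * ((2 * s + 1) * catalan s) ≤ catalan (3 * s + 2) := by
  obtain ⟨ζ, hζ, hω⟩ := exists_root_tau_class (nm := 3 * (2 * s + 1)) rfl (by omega)
  have key := finrank_eigenspace_of_eq_tau (nm := 3 * (2 * s + 1)) rfl (by omega) hζ hω
  rw [finrank_solW_three_mul_odd rfl, triN_eq] at key
  have h0 : (0 : ℝ) ≤ ((3 * (2 * s + 1) : ℕ) : ℝ) * (Module.finrank ℂ (LinearMap.range (twProj (3 * (2 * s + 1)) ζ)) : ℝ) := by positivity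
  have e := congrArg Complex.re key
  simp only [Complex.mul_re, Complex.natCast_re, Complex.natCast_im, mul_zero, sub_zero, Complex.sub_re, Complex.re_ofNat,
    Complex.im_ofNat] at e
  have h1 : (2 : ℝ) * (((2 * s + 1) * catalan s : ℕ) : ℝ) ≤ (catalan (3 * s + 2) : ℝ) := by linarith
  exact_mod_cast h1

/-- ★★★ **THE MULTIPLICITIES IN NATURAL NUMBERS, odd `k = 3(2s+1)`, `τ`-class** (`ζ^k = 1`, `ζ^{-(2s+1)} = τ`; one third of the roots of unity):
`k · dim E_ζ = C_{3s+2} − 2 (2s+1) C_s` (k = 3: `0` for `ζ = τ²`; k = 9: `4`). [cite: KhristoforovSmirnov2021, §2 Lemma 4, proof and Fig. 3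
(arXiv v1 p. 4); §1.2 (p. 2: cyclic indexing)] -/
theorem mul_finrank_eigenspace_of_eq_tau {s : ℕ} (hr : 3 * (2 * s + 1) = nm) {ζ : ℂ} (hζ : ζ ^ nm = 1) (hω : (ζ⁻¹) ^ (2 * s + 1) = tau) :
    nm * Module.finrank ℂ (LinearMap.range (twProj nm ζ)) = catalan (3 * s + 2) - 2 * ((2 * s + 1) * catalan s) := by
  have key := finrank_eigenspace_of_eq_tau hr (by omega) hζ hω
  rw [finrank_solW_three_mul_odd hr, triN_eq] at key
  have hle := two_mul_triangles_le_catalan s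
  have key' : ((nm * Module.finrank ℂ (LinearMap.range (twProj nm ζ)) : ℕ) : ℂ) =
      ((catalan (3 * s + 2) - 2 * ((2 * s + 1) * catalan s) : ℕ) : ℂ) := by
    rw [Nat.cast_mul, Nat.cast_sub hle, key]
    push_cast
    ring
  exact_mod_cast key'

/-- ★★★ **THE MULTIPLICITIES IN NATURAL NUMBERS, odd `k = 3(2s+1)`, the other two classes** (`ζ^{-(2s+1)} ≠ τ`; two thirds of the roots of
unity, including `ζ = 1`): `k · dim E_ζ = C_{3s+2} + (2s+1) C_s` (k = 3: `1`; k = 9: `5`; check `6·5 + 3·4 = 42 = C_5`).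
[cite: KhristoforovSmirnov2021, §2 Lemma 4, proof and Fig. 3 (arXiv v1 p. 4); §1.2 (p. 2: cyclic indexing)] -/
theorem mul_finrank_eigenspace_of_ne_tau {s : ℕ} (hr : 3 * (2 * s + 1) = nm) {ζ : ℂ} (hζ : ζ ^ nm = 1) (hω : (ζ⁻¹) ^ (2 * s + 1) ≠ tau) :
    nm * Module.finrank ℂ (LinearMap.range (twProj nm ζ)) = catalan (3 * s + 2) + (2 * s + 1) * catalan s := by
  have key := finrank_eigenspace_of_ne_tau hr (by omega) hζ hω
  rw [finrank_solW_three_mul_odd hr, triN_eq] at key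
  exact_mod_cast key

/-- ★★ **THE INVARIANT SOLUTIONS** (`ζ = 1`): for odd `k = 3(2s+1)` the rotation-invariant tripod-law solutions have dimension
`(C_{3s+2} + (2s+1) C_s)/k` — `k · dim = C_{3s+2} + (2s+1) C_s` (k = 3: one invariant line; k = 9: five). [cite: KhristoforovSmirnov2021, §2
Lemma 4, proof and Fig. 3 (arXiv v1 p. 4); §1.2 (p. 2)] -/
theorem mul_finrank_invariants_three_mul {s : ℕ} (hr : 3 * (2 * s + 1) = nm) :
    nm * Module.finrank ℂ (LinearMap.range (twProj nm 1)) = catalan (3 * s + 2) + (2 * s + 1) * catalan s := by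
  refine mul_finrank_eigenspace_of_ne_tau hr (by rw [one_pow]) ?_
  rw [inv_one, one_pow]
  intro h
  have h3 := tau_facts.1
  rw [← h] at h3
  norm_num at h3

/-- ★ **ARITHMETIC SHADOWS**: `3(2s+1)` divides `C_{3s+2} + (2s+1) C_s` and `C_{3s+2} − 2 (2s+1) C_s` (e.g. `9 ∣ 42 + 3`, `9 ∣ 42 − 6`;
`15 ∣ 1430 + 10`, `15 ∣ 1430 − 20`) — read off the representation, as REP's `dvd_card_ncMatching` was for `3 ∤ k`.
[cite: KhristoforovSmirnov2021, §2 Lemma 4, proof and Fig. 3 (arXiv v1 p. 4)] -/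
theorem dvd_catalan_add_and_sub (s : ℕ) :
    3 * (2 * s + 1) ∣ catalan (3 * s + 2) + (2 * s + 1) * catalan s ∧ 3 * (2 * s + 1) ∣ catalan (3 * s + 2) - 2 * ((2 * s + 1) * catalan s) := by
  obtain ⟨ζ, hζ, hω⟩ := exists_root_tau_class (nm := 3 * (2 * s + 1)) rfl (by omega)
  exact ⟨Dvd.intro _ (mul_finrank_invariants_three_mul (nm := 3 * (2 * s + 1)) rfl),
    Dvd.intro _ (mul_finrank_eigenspace_of_eq_tau (nm := 3 * (2 * s + 1)) rfl hζ hω)⟩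

/-- sanity instances (k = 3 and k = 9): `3 · dim E_1 = 3`, i.e. one invariant line at three disorders; at nine disorders `9 · dim E_1 = 45` and
the `τ`-class has `9 · dim = 36`; the divisibilities `9 ∣ 45`, `9 ∣ 36`, `15 ∣ 1440`, `15 ∣ 1410`. [cite: KhristoforovSmirnov2021, §2 Lemma 4 (arXiv v1 p. 4)] -/
theorem multiplicities_three_nine : 3 * Module.finrank ℂ (LinearMap.range (twProj 3 1)) = 3 ∧
    9 * Module.finrank ℂ (LinearMap.range (twProj 9 1)) = 45 ∧ (15 ∣ 1440 ∧ 15 ∣ 1410) := by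
  have c4 : catalan 5 = 42 := by norm_num [catalan_eq_centralBinom_div, Nat.centralBinom, Nat.choose]
  refine ⟨?_, ?_, by norm_num⟩
  · have h := mul_finrank_invariants_three_mul (s := 0) (nm := 3) (by norm_num)
    rw [catalan_two, catalan_zero] at h
    simpa using h
  · have h := mul_finrank_invariants_three_mul (s := 1) (nm := 9) (by norm_num)
    rw [c4, catalan_one] at h
    simpa using h

/-! #### For comparison: `3 ∤ k` in Catalan numbers (REP's freeness, evaluated by LINK-CATALAN) -/

/-- ★★ **`3 ∤ k = 2l+1`: EVERY `k`-th root of unity has multiplicity `C_{l+1} / k`** — REP's `finrank_solW_eq_mul_finrank_eigenspace` with the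
dimension evaluated: `k · dim E_ζ = C_{l+1}` (k = 5: `1`; k = 7: `2`; k = 11: `12`; k = 13: `33`). Together with the `3 ∣ k` table above this is the
`ℂ[Z/k]`-module structure of the tripod-law solution space for EVERY odd `k`. [cite: KhristoforovSmirnov2021, §2 Lemma 4, proof and Fig. 3 (arXiv
v1 p. 4); §1.2 (p. 2: cyclic indexing)] -/
theorem mul_finrank_eigenspace_of_coprime {l : ℕ} (hk : 2 * l + 1 = nm) (h3 : Nat.Coprime 3 nm) {ζ : ℂ} (hζ : ζ ^ nm = 1) :
    nm * Module.finrank ℂ (LinearMap.range (twProj nm ζ)) = catalan (l + 1) := by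
  rw [← finrank_solW_eq_mul_finrank_eigenspace h3 (by omega) hζ, ← hk, finrank_solW_eq_catalan]

/-- … hence `k ∣ C_{(k+1)/2}` for `3 ∤ k` (REP's `dvd_card_ncMatching` in Catalan form: `5 ∣ 5`, `7 ∣ 14`, `11 ∣ 132`, `13 ∣ 429`; sharp: `9 ∤ 42`).
[cite: KhristoforovSmirnov2021, §2 Lemma 4, proof and Fig. 3 (arXiv v1 p. 4)] -/
theorem dvd_catalan_of_coprime {l : ℕ} (h3 : Nat.Coprime 3 (2 * l + 1)) : 2 * l + 1 ∣ catalan (l + 1) :=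
  Dvd.intro _ (mul_finrank_eigenspace_of_coprime (nm := 2 * l + 1) rfl h3 (ζ := 1) (by rw [one_pow]))

/-! #### Not free when `3 ∣ k` -/

/-- Catalan numbers are positive (from `succ_mul_catalan_eq_centralBinom`). [folklore] -/
private theorem catalan_pos' (n : ℕ) : 0 < catalan n := by
  have h := succ_mul_catalan_eq_centralBinom n
  have hc := Nat.centralBinom_pos n
  by_contra h0
  rw [Nat.eq_zero_of_not_pos h0, mul_zero] at h
  omega

/-- ★★ **FOR `3 ∣ k` THE SOLUTION SPACE IS NOT A FREE `ℂ[Z/k]`-MODULE**: an eigenvalue in the `τ`-class has strictly smaller multiplicity than one outside it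
(`k · (dim E_{ζ'} − dim E_ζ) = 3 (2s+1) C_s > 0`) — in contrast with REP's freeness for `3 ∤ k`. [cite: KhristoforovSmirnov2021, §2 Lemma 4, proof and
Fig. 3 (arXiv v1 p. 4); §1.2 (p. 2: cyclic indexing)] -/
theorem finrank_eigenspace_lt_of_three_mul {s : ℕ} (hr : 3 * (2 * s + 1) = nm) {ζ ζ' : ℂ} (hζ : ζ ^ nm = 1) (hω : (ζ⁻¹) ^ (2 * s + 1) = tau)
    (hζ' : ζ' ^ nm = 1) (hω' : (ζ'⁻¹) ^ (2 * s + 1) ≠ tau) :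
    Module.finrank ℂ (LinearMap.range (twProj nm ζ)) < Module.finrank ℂ (LinearMap.range (twProj nm ζ')) := by
  have h1 := mul_finrank_eigenspace_of_eq_tau hr hζ hω
  have h2 := mul_finrank_eigenspace_of_ne_tau hr hζ' hω'
  have hN : 0 < (2 * s + 1) * catalan s := Nat.mul_pos (by omega) (catalan_pos' s)
  have hlt : nm * Module.finrank ℂ (LinearMap.range (twProj nm ζ)) < nm * Module.finrank ℂ (LinearMap.range (twProj nm ζ')) := by
    rw [h1, h2]; omega
  exact Nat.lt_of_mul_lt_mul_left hlt

/-- … concretely the invariant solutions (`ζ' = 1`) outnumber the `τ`-class (`ζ₀ = e^{4πi/k}`): such a pair always exists. [cite: KhristoforovSmirnov2021, §2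
Lemma 4, proof and Fig. 3 (arXiv v1 p. 4)] -/
theorem exists_finrank_eigenspace_lt {s : ℕ} (hr : 3 * (2 * s + 1) = nm) :
    ∃ ζ : ℂ, ζ ^ nm = 1 ∧ Module.finrank ℂ (LinearMap.range (twProj nm ζ)) < Module.finrank ℂ (LinearMap.range (twProj nm 1)) := by
  obtain ⟨ζ, hζ, hω⟩ := exists_root_tau_class hr (by omega)
  refine ⟨ζ, hζ, finrank_eigenspace_lt_of_three_mul hr hζ hω (by rw [one_pow]) ?_⟩
  rw [inv_one, one_pow]
  intro h
  have h3 := tau_facts.1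
  rw [← h] at h3
  norm_num at h3

end OrderThreeModule

end Literature.Probability.Percolation.MarkedLoops
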